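import Literature.Barriers.Parity.SiegelZeroDichotomyChowlaStep3
import Literature.Barriers.Parity.SiegelZeroDichotomyChowlaLemma61
import HarnessLib

/-!
# Step (iii) of Tao–Teräväinen at `k = 0` — the discharge `TaoTeravainen2021_prop63_k0_holds`

Topic `Literature/Barriers/Parity`; closes the named fact
`Literature.Barriers.Parity.TaoTeravainen2021_prop63_k0` (Proposition 6.3 at `k = 0`,
`SiegelZeroDichotomyChowla.lean`) by combining the PROVED reduction
`TaoTeravainen2021_prop63_k0_of_lemma61` (`SiegelZeroDichotomyChowlaStep3.lean`) with the PROVED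
Lemma 6.1 `TaoTeravainen2021_lemma61_holds` (`SiegelZeroDichotomyChowlaLemma61.lean`).

T. Tao, J. Teräväinen (arXiv:2109.06291), Proposition 6.3 (`λ_Siegel ≈ λ♯_Siegel` on average) at
`k = 0`. [cite: TaoTeravainen2021, Proposition 6.3 with Lemma 6.1]
-/

namespace Literature.Barriers.Parity

/-- **Tao–Teräväinen 2022, Proposition 6.3 at `k = 0` — PROVED** (step (iii) of the proof of
Corollary 1.8 (ii)). [cite: TaoTeravainen2021, Proposition 6.3] -/
theorem TaoTeravainen2021_prop63_k0_holds : TaoTeravainen2021_prop63_k0 :=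
  TaoTeravainen2021_prop63_k0_of_lemma61 TaoTeravainen2021_lemma61_holds

end Literature.Barriers.Parity
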